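import Summits.ResolutionOfSingularities.ResolutionOfSingularities.Theorems.WildConesCampaignW46HypersurfacesCharTwoCubeCriterion

/-!
# [OURS · L1 W4.6, rung (ii) at p = 2, EVERY dimension n] TWO FREE POINTS GIVE A THIRD: at a corank-two double
# point of `z² = a(u₁,…,uₙ)` (any field of characteristic 2), two non-proportional FREE infinitely-near double
# points `[w₁], [w₂]` determine a THIRD one, `[m₂w₁ + m₁w₂]` (`mᵢ` the mixed polars), free and distinct from both —
# so in the three-tangents class the number of infinitely-near double points is `0`, `1` or `3`, NEVER `2`

HONEST FRAMING. Everything here is OURS: theorems about route WildCones' own TYPED point-blow-up dynamics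
(`Theorems/WildConesClassicalRegimesDefs.lean`) and the seat's invariants `polarMatrix` (p502936),
`milnorEmbDim` (p498937), `milnorHilbertTwo` (p511581), `degForm` (p522667). NOTHING here is a statement of the
manuscript [Hironaka2017]; no FACT-LIST premise; AI review is weaker than expert review. Cell res-hironaka
(LADDER-RESOLUTION rung L, D-0089), slot W4.6, seat res-L1-s46-pv-4 (gen 6); host route `WildCones`, crux
`ClassicalRegimes` (stmt-ResolutionOfSingularities-16884; proved).

THE ARGUMENT. Let `w₁, w₂` be non-proportional kernel vectors on the tangent cubic (`a₃(wᵢ) = 0`), both free, and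
`m₁ = polar(w₂, w₁)`, `m₂ = polar(w₁, w₂)` the mixed polars — non-zero exactly because the points are free (p544683's
argument: `polar(wᵢ, wᵢ) = a₃(wᵢ) = 0`). In the basis `w₁, w₂` the kernel cubic is `g(s, t) = st(m₁s + m₂t)` (cubic
polarization, p543928), whose third root is `[s : t] = [m₂ : m₁]`: the vector `w₃ = m₂w₁ + m₁w₂` has
`a₃(w₃) = m₁²m₂² + m₁²m₂² = 0`, is proportional to neither `w₁` nor `w₂` (`m₁, m₂ ≠ 0`), and is FREE:
`polar(w₁, w₃) = m₁²m₂ ≠ 0` (quadratic polarization, `T(w₁; w₁, ·) = 0`). A square-free binary cubic with two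
rational roots has three.

WHAT IS PROVED (every `n`, every field of characteristic `2`, corank `e(c) = 2`):

* `polar_self_add` — `polar(w, aw + bv) = a²·polar(w, w) + b²·polar(w, v)`;
* `hypersurface_mixed_polars_ne_zero` — for two non-proportional free near vectors the mixed polars are non-zero;
* `hypersurface_third_free_vector` — the vector `w₃ = m₂w₁ + m₁w₂`: kernel, on the cubic, free (`polar(w₁,w₃) ≠ 0`),
  proportional to neither `w₁` nor `w₂`;
* `hypersurface_third_free_point` — (isolated) hence a THIRD double successor of corank `0`, at a near point
  distinct from `[w₁]`, `[w₂]`;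
* `hypersurface_third_free_successor` — dynamic form: two double successors of corank `0` with non-proportional
  near vectors ⇒ a third double successor of corank `0` whose near vector is proportional to neither; with
  p543928 (`≤ 3`): at `(e, h₂) = (2, 1)` the number of infinitely-near double points is `0`, `1` or `3`.

References: [CasasAlvero2000] §3 (context only); [GreuelPfister2026] (context); [Hironaka2017] Th. 16.6 p.84 —
role replaced only, under adjudication; nothing of it is used.
-/

noncomputable section

-- single-problem summit: the doubled namespace component `ResolutionOfSingularities` is forced
set_option linter.dupNamespace false

open scoped BigOperators Classical

open MvPowerSeries IsLocalRing

open Literature.AlgebraicGeometry.Resolution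

namespace Summit.ResolutionOfSingularities.ResolutionOfSingularities.Theorems

namespace CampaignW46.HypersurfacesCharTwo

open WildCones WildCones.MuDropCharTwoOrdP ThreefoldsCharTwo

variable {κ : Type} [Field κ] {n : ℕ}

/-! ## Polars along the first argument's own line -/

/-- [OURS · L1 W4.6] Characteristic two: `polar(w, a·w + b·v) = a²·polar(w, w) + b²·polar(w, v)` (quadratic
polarization p536239; the cross term `T(w; w, v)` vanishes). [folklore] -/
theorem polar_self_add [CharP κ 2] (f : MvPowerSeries (Fin n) κ) (w v : Fin n → κ) (a b : κ) :
    ∑ s, w s * degForm 2 (MvPowerSeries.pderiv s f) (a • w + b • v) =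
      a ^ 2 * ∑ s, w s * degForm 2 (MvPowerSeries.pderiv s f) w +
        b ^ 2 * ∑ s, w s * degForm 2 (MvPowerSeries.pderiv s f) v := by
  have hcross : ∑ s, (a • w) s * degForm 1 (MvPowerSeries.pderiv s
      (∑ l, C (w l) * MvPowerSeries.pderiv l f)) (b • v) = 0 := by
    have h := polarCross_self_eq_zero f w v
    have hlin : ∑ s, (a • w) s * degForm 1 (MvPowerSeries.pderiv s
        (∑ l, C (w l) * MvPowerSeries.pderiv l f)) (b • v) =
        a * b * ∑ s, w s * degForm 1 (MvPowerSeries.pderiv s (∑ l, C (w l) * MvPowerSeries.pderiv l f)) v := by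
      rw [Finset.mul_sum]
      refine Finset.sum_congr rfl fun s _ => ?_
      rw [Pi.smul_apply, smul_eq_mul, degForm_smul_vec, pow_one]
      ring
    rw [hlin, h, mul_zero]
  rw [← degForm_two_sum_C_mul_pderiv f w (a • w + b • v), degForm_two_add, hcross, add_zero,
    degForm_two_sum_C_mul_pderiv f w (a • w), degForm_two_sum_C_mul_pderiv f w (b • v), polar_smul_right,
    polar_smul_right]

/-! ## Two free near points and their mixed polars -/

/-- [OURS · L1 W4.6] **The mixed polars of two non-proportional free near vectors are non-zero** (corank two):
with `w₁ ≠ 0`, `w₂ ∉ κw₁` kernel vectors on the cubic, `polar(wᵢ, wᵢ) = a₃(wᵢ) = 0` (Euler), so the polar that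
witnesses the freeness of `w₁` is a multiple of `m₁ = polar(w₂, w₁)`, and symmetrically. [folklore] -/
theorem hypersurface_mixed_polars_ne_zero [CharP κ 2] (c : (Fin n → ℕ) → κ) (hM : MultP 2 n κ c)
    (he : milnorEmbDim 2 n κ c = 2) {w₁ w₂ : Fin n → κ} (hw₁0 : w₁ ≠ 0)
    (hw₁ : Matrix.vecMul w₁ (polarMatrix (ser 2 n κ c)) = 0)
    (hw₂ : Matrix.vecMul w₂ (polarMatrix (ser 2 n κ c)) = 0) (hnot : ∀ r : κ, w₂ ≠ r • w₁)
    (hc₁ : degForm 3 (ser 2 n κ c) w₁ = 0) (hc₂ : degForm 3 (ser 2 n κ c) w₂ = 0)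
    (hf₁ : ∃ v : Fin n → κ, Matrix.vecMul v (polarMatrix (ser 2 n κ c)) = 0 ∧
      ∑ s, v s * degForm 2 (MvPowerSeries.pderiv s (ser 2 n κ c)) w₁ ≠ 0)
    (hf₂ : ∃ v : Fin n → κ, Matrix.vecMul v (polarMatrix (ser 2 n κ c)) = 0 ∧
      ∑ s, v s * degForm 2 (MvPowerSeries.pderiv s (ser 2 n κ c)) w₂ ≠ 0) :
    ∑ s, w₂ s * degForm 2 (MvPowerSeries.pderiv s (ser 2 n κ c)) w₁ ≠ 0 ∧
      ∑ s, w₁ s * degForm 2 (MvPowerSeries.pderiv s (ser 2 n κ c)) w₂ ≠ 0 := by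
  set f := ser 2 n κ c with hfdef
  have hd₁ : ∑ s, w₁ s * degForm 2 (MvPowerSeries.pderiv s f) w₁ = 0 := by
    rw [← degForm_three_eq_polar_self]; exact hc₁
  have hd₂ : ∑ s, w₂ s * degForm 2 (MvPowerSeries.pderiv s f) w₂ = 0 := by
    rw [← degForm_three_eq_polar_self]; exact hc₂
  constructor
  · obtain ⟨v, hv, hne⟩ := hf₁
    obtain ⟨α, β, hαβ⟩ := kernel_span_pair hM he hw₁0 hw₁ hw₂ hnot v hv
    rw [← hαβ, polar_add_smul, hd₁, mul_zero, zero_add] at hne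
    exact fun h0 => hne (by rw [h0, mul_zero])
  · obtain ⟨v, hv, hne⟩ := hf₂
    obtain ⟨α, β, hαβ⟩ := kernel_span_pair hM he hw₁0 hw₁ hw₂ hnot v hv
    rw [← hαβ, polar_add_smul, hd₂, mul_zero, add_zero] at hne
    exact fun h0 => hne (by rw [h0, mul_zero])

/-! ## The third free vector -/

/-- [OURS · L1 W4.6 rung (ii) at `p = 2`, every dimension; NOT a statement of the manuscript] **TWO FREE NEAR
POINTS DETERMINE A THIRD.** Let `c` be a double state of `z² = a(u₁,…,uₙ)` (any field of characteristic `2`) with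
`e(c) = 2`, and `w₁, w₂` non-proportional kernel vectors on the tangent cubic, both FREE. With the mixed polars
`m₁ = polar(w₂, w₁)`, `m₂ = polar(w₁, w₂)`, the vector `w₃ = m₂w₁ + m₁w₂` is a kernel vector ON the cubic
(`a₃(w₃) = 2m₁²m₂² = 0`), FREE (`polar(w₁, w₃) = m₁²m₂ ≠ 0`), and proportional to NEITHER `w₁` NOR `w₂` — the third
root `[m₂ : m₁]` of the kernel cubic `st(m₁s + m₂t)`. [folklore] -/
theorem hypersurface_third_free_vector [CharP κ 2] (c : (Fin n → ℕ) → κ) (hM : MultP 2 n κ c)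
    (he : milnorEmbDim 2 n κ c = 2) {w₁ w₂ : Fin n → κ} (hw₁0 : w₁ ≠ 0)
    (hw₁ : Matrix.vecMul w₁ (polarMatrix (ser 2 n κ c)) = 0)
    (hw₂ : Matrix.vecMul w₂ (polarMatrix (ser 2 n κ c)) = 0) (hnot : ∀ r : κ, w₂ ≠ r • w₁)
    (hc₁ : degForm 3 (ser 2 n κ c) w₁ = 0) (hc₂ : degForm 3 (ser 2 n κ c) w₂ = 0)
    (hf₁ : ∃ v : Fin n → κ, Matrix.vecMul v (polarMatrix (ser 2 n κ c)) = 0 ∧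
      ∑ s, v s * degForm 2 (MvPowerSeries.pderiv s (ser 2 n κ c)) w₁ ≠ 0)
    (hf₂ : ∃ v : Fin n → κ, Matrix.vecMul v (polarMatrix (ser 2 n κ c)) = 0 ∧
      ∑ s, v s * degForm 2 (MvPowerSeries.pderiv s (ser 2 n κ c)) w₂ ≠ 0) :
    Matrix.vecMul ((∑ s, w₁ s * degForm 2 (MvPowerSeries.pderiv s (ser 2 n κ c)) w₂) • w₁ +
        (∑ s, w₂ s * degForm 2 (MvPowerSeries.pderiv s (ser 2 n κ c)) w₁) • w₂) (polarMatrix (ser 2 n κ c)) = 0 ∧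
      degForm 3 (ser 2 n κ c) ((∑ s, w₁ s * degForm 2 (MvPowerSeries.pderiv s (ser 2 n κ c)) w₂) • w₁ +
        (∑ s, w₂ s * degForm 2 (MvPowerSeries.pderiv s (ser 2 n κ c)) w₁) • w₂) = 0 ∧
      ∑ s, w₁ s * degForm 2 (MvPowerSeries.pderiv s (ser 2 n κ c))
        ((∑ s, w₁ s * degForm 2 (MvPowerSeries.pderiv s (ser 2 n κ c)) w₂) • w₁ +
          (∑ s, w₂ s * degForm 2 (MvPowerSeries.pderiv s (ser 2 n κ c)) w₁) • w₂) ≠ 0 ∧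
      (∀ r : κ, (∑ s, w₁ s * degForm 2 (MvPowerSeries.pderiv s (ser 2 n κ c)) w₂) • w₁ +
          (∑ s, w₂ s * degForm 2 (MvPowerSeries.pderiv s (ser 2 n κ c)) w₁) • w₂ ≠ r • w₁) ∧
      ∀ r : κ, (∑ s, w₁ s * degForm 2 (MvPowerSeries.pderiv s (ser 2 n κ c)) w₂) • w₁ +
          (∑ s, w₂ s * degForm 2 (MvPowerSeries.pderiv s (ser 2 n κ c)) w₁) • w₂ ≠ r • w₂ := by
  set f := ser 2 n κ c with hfdef
  set m₁ := ∑ s, w₂ s * degForm 2 (MvPowerSeries.pderiv s f) w₁ with hm₁def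
  set m₂ := ∑ s, w₁ s * degForm 2 (MvPowerSeries.pderiv s f) w₂ with hm₂def
  obtain ⟨hm₁, hm₂⟩ : m₁ ≠ 0 ∧ m₂ ≠ 0 :=
    hypersurface_mixed_polars_ne_zero c hM he hw₁0 hw₁ hw₂ hnot hc₁ hc₂ hf₁ hf₂
  have hd₁ : ∑ s, w₁ s * degForm 2 (MvPowerSeries.pderiv s f) w₁ = 0 := by
    rw [← degForm_three_eq_polar_self]; exact hc₁
  have hw₂0 : w₂ ≠ 0 := fun h0 => hnot 0 (by rw [h0, zero_smul])
  refine ⟨?_, ?_, ?_, fun r h => ?_, fun r h => ?_⟩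
  · rw [Matrix.add_vecMul, Matrix.smul_vecMul, Matrix.smul_vecMul, hw₁, hw₂, smul_zero, smul_zero, add_zero]
  · rw [degForm_three_add, degForm_smul_vec, degForm_smul_vec, hc₁, hc₂, mul_zero, mul_zero, zero_add, add_zero,
      polar_smul_left, polar_smul_right, polar_smul_left, polar_smul_right, ← hm₁def, ← hm₂def]
    calc m₁ * (m₂ ^ 2 * m₁) + m₂ * (m₁ ^ 2 * m₂) = (m₁ * m₂) ^ 2 + (m₁ * m₂) ^ 2 := by ring
      _ = 0 := CharTwo.add_self_eq_zero _
  · rw [polar_self_add, hd₁, mul_zero, zero_add, ← hm₂def]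
    exact mul_ne_zero (pow_ne_zero 2 hm₁) hm₂
  · -- `m₂ w₁ + m₁ w₂ = r w₁` would make `w₂` a multiple of `w₁`
    apply hnot (m₁⁻¹ * (r - m₂))
    funext j
    have hj := congrFun h j
    simp only [Pi.add_apply, Pi.smul_apply, smul_eq_mul] at hj ⊢
    calc w₂ j = m₁⁻¹ * (m₁ * w₂ j) := by rw [← mul_assoc, inv_mul_cancel₀ hm₁, one_mul]
      _ = m₁⁻¹ * (r - m₂) * w₁ j := by
        rw [show m₁ * w₂ j = (r - m₂) * w₁ j by linear_combination hj]
        ring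
  · -- `m₂ w₁ + m₁ w₂ = r w₂` would make `w₁` a multiple of `w₂`, hence `w₂` one of `w₁`
    have hw₁eq : w₁ = (m₂⁻¹ * (r - m₁)) • w₂ := by
      funext j
      have hj := congrFun h j
      simp only [Pi.add_apply, Pi.smul_apply, smul_eq_mul] at hj ⊢
      calc w₁ j = m₂⁻¹ * (m₂ * w₁ j) := by rw [← mul_assoc, inv_mul_cancel₀ hm₂, one_mul]
        _ = m₂⁻¹ * (r - m₁) * w₂ j := by
          rw [show m₂ * w₁ j = (r - m₁) * w₂ j by linear_combination hj]
          ring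
    set s := m₂⁻¹ * (r - m₁) with hsdef
    by_cases hs : s = 0
    · exact hw₁0 (by rw [hw₁eq, hs, zero_smul])
    · exact hnot s⁻¹ (by rw [hw₁eq, smul_smul, inv_mul_cancel₀ hs, one_smul])

/-- [OURS · L1 W4.6 rung (ii) at `p = 2`, every dimension; NOT a statement of the manuscript] **A THIRD FREE
NEAR DOUBLE POINT**: for an ISOLATED double state with `e(c) = 2` and two non-proportional free near vectors
`w₁, w₂` as above, there are a chart and a translation giving a double successor of corank `0` (free: isolated,
`μ = 1`, nothing after) whose near vector is proportional to NEITHER `w₁` NOR `w₂`. [folklore] -/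
theorem hypersurface_third_free_point [CharP κ 2] (c : (Fin n → ℕ) → κ) (hM : MultP 2 n κ c) (hI : Isol 2 n κ c)
    (he : milnorEmbDim 2 n κ c = 2) {w₁ w₂ : Fin n → κ} (hw₁0 : w₁ ≠ 0)
    (hw₁ : Matrix.vecMul w₁ (polarMatrix (ser 2 n κ c)) = 0)
    (hw₂ : Matrix.vecMul w₂ (polarMatrix (ser 2 n κ c)) = 0) (hnot : ∀ r : κ, w₂ ≠ r • w₁)
    (hc₁ : degForm 3 (ser 2 n κ c) w₁ = 0) (hc₂ : degForm 3 (ser 2 n κ c) w₂ = 0)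
    (hf₁ : ∃ v : Fin n → κ, Matrix.vecMul v (polarMatrix (ser 2 n κ c)) = 0 ∧
      ∑ s, v s * degForm 2 (MvPowerSeries.pderiv s (ser 2 n κ c)) w₁ ≠ 0)
    (hf₂ : ∃ v : Fin n → κ, Matrix.vecMul v (polarMatrix (ser 2 n κ c)) = 0 ∧
      ∑ s, v s * degForm 2 (MvPowerSeries.pderiv s (ser 2 n κ c)) w₂ ≠ 0) :
    ∃ (i : Fin n) (τ : Fin n → κ), MultP 2 n κ (step 2 n κ i τ c) ∧ milnorEmbDim 2 n κ (step 2 n κ i τ c) = 0 ∧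
      (∀ r : κ, Function.update τ i 1 ≠ r • w₁) ∧ ∀ r : κ, Function.update τ i 1 ≠ r • w₂ := by
  obtain ⟨hk₃, hc₃, hp₃, hn₁, hn₂⟩ := hypersurface_third_free_vector c hM he hw₁0 hw₁ hw₂ hnot hc₁ hc₂ hf₁ hf₂
  set w₃ := (∑ s, w₁ s * degForm 2 (MvPowerSeries.pderiv s (ser 2 n κ c)) w₂) • w₁ +
    (∑ s, w₂ s * degForm 2 (MvPowerSeries.pderiv s (ser 2 n κ c)) w₁) • w₂ with hw₃
  have hw₃0 : w₃ ≠ 0 := fun h0 => hn₁ 0 (by rw [h0, zero_smul])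
  obtain ⟨i, hi⟩ : ∃ i, w₃ i ≠ 0 := by
    by_contra h
    push Not at h
    exact hw₃0 (funext h)
  have hM' := hypersurface_multP_step_of_vec c hM hI hi hk₃ hc₃
  refine ⟨i, _, hM', (hypersurface_milnorEmbDim_step_eq_zero_iff c i _ hM he hM').mpr ⟨w₁, hw₁, ?_⟩, ?_, ?_⟩
  · rw [update_inv_smul_eq hi, polar_smul_right]
    exact mul_ne_zero (pow_ne_zero 2 (inv_ne_zero hi)) hp₃
  · intro r h
    rw [update_inv_smul_eq hi] at h
    apply hn₁ (w₃ i * r)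
    have := congrArg (fun z => w₃ i • z) h
    simp only [smul_smul, mul_inv_cancel₀ hi, one_smul] at this
    exact this
  · intro r h
    rw [update_inv_smul_eq hi] at h
    apply hn₂ (w₃ i * r)
    have := congrArg (fun z => w₃ i • z) h
    simp only [smul_smul, mul_inv_cancel₀ hi, one_smul] at this
    exact this

/-- [OURS · L1 W4.6 rung (ii) at `p = 2`, every dimension, every field of characteristic `2`; NOT a statement of the
manuscript] **NEVER EXACTLY TWO**: for an isolated double state with `e(c) = 2`, if `(i₁, τ₁)` and `(i₂, τ₂)` give
double successors of corank `0` with non-proportional near vectors, then some `(i₃, τ₃)` gives a third double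
successor of corank `0` whose near vector is proportional to neither. With the census (`≤ 3`, p543928; all near
points free at `h₂ = 1`, p513980) the three-tangents class has `0`, `1` or `3` infinitely-near double points.
[folklore] -/
theorem hypersurface_third_free_successor [CharP κ 2] (c : (Fin n → ℕ) → κ) (hM : MultP 2 n κ c)
    (hI : Isol 2 n κ c) (he : milnorEmbDim 2 n κ c = 2) {i₁ i₂ : Fin n} {τ₁ τ₂ : Fin n → κ}
    (hM₁ : MultP 2 n κ (step 2 n κ i₁ τ₁ c)) (hM₂ : MultP 2 n κ (step 2 n κ i₂ τ₂ c))
    (he₁ : milnorEmbDim 2 n κ (step 2 n κ i₁ τ₁ c) = 0) (he₂ : milnorEmbDim 2 n κ (step 2 n κ i₂ τ₂ c) = 0)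
    (hnot : ∀ r : κ, Function.update τ₂ i₂ 1 ≠ r • Function.update τ₁ i₁ 1) :
    ∃ (i₃ : Fin n) (τ₃ : Fin n → κ), MultP 2 n κ (step 2 n κ i₃ τ₃ c) ∧
      milnorEmbDim 2 n κ (step 2 n κ i₃ τ₃ c) = 0 ∧
      (∀ r : κ, Function.update τ₃ i₃ 1 ≠ r • Function.update τ₁ i₁ 1) ∧
        ∀ r : κ, Function.update τ₃ i₃ 1 ≠ r • Function.update τ₂ i₂ 1 := by
  obtain ⟨hk₁, hc₁⟩ := hypersurface_ker_and_cubic_of_double_successor c i₁ τ₁ hM hM₁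
  obtain ⟨hk₂, hc₂⟩ := hypersurface_ker_and_cubic_of_double_successor c i₂ τ₂ hM hM₂
  have hf₁ := (hypersurface_milnorEmbDim_step_eq_zero_iff c i₁ τ₁ hM he hM₁).mp he₁
  have hf₂ := (hypersurface_milnorEmbDim_step_eq_zero_iff c i₂ τ₂ hM he hM₂).mp he₂
  exact hypersurface_third_free_point c hM hI he (update_one_ne_zero τ₁ i₁) hk₁ hk₂ hnot hc₁ hc₂ hf₁ hf₂

end CampaignW46.HypersurfacesCharTwo

end Summit.ResolutionOfSingularities.ResolutionOfSingularities.Theorems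

end
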